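import Summits.Ventures.DiscreteObjects.Hadamard.IntertwinedTraceBound

/-!
# Intertwined orthogonal matrices of finite order: `Σ_{j<N} (tr Pʲ − tr Rʲ) ≥ 0` (kernel tool for the averaged rank test)

Framing: lottery ticket; floor = certified bounds/negative ranges.  Cell pub-namedobj (venture DiscreteObjects),
target (H) = `H(668)`, hadamard gen 31.  Mathlib-only sequel to `IntertwinedTraceBound`: besides `|tr(PʲQ)| ≤ tr Q` for each power, the
AVERAGE of the traces is non-negative — the multiplicity of the trivial character of `⟨P⟩` on the image of the projection `Q`:
* `trace_sum_pow_mul_proj_nonneg` — `P` orthogonal with `P^N = 1` (`N > 0`), `Q` a symmetric idempotent commuting with `P`: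
  `0 ≤ Σ_{j<N} tr(Pʲ Q)` (with `S = Σ Pʲ`: `P S = S`, `Sᵀ S = N•S`, hence `N·tr(SQ) = ‖SQ‖_F² ≥ 0`);
* `trace_mul_proj_eq_of_intertwining` — `B Bᵀ K = 1`, `R`, `P` orthogonal, `B P = R B` ⇒ `tr(P·BᵀKB) = tr R`;
* **`trace_pow_sub_sum_nonneg_of_intertwining`** — under the same hypotheses and `P^N = 1`, `R^N = 1`: `0 ≤ Σ_{j<N} (tr Pʲ − tr Rʲ)`.
Intended instance (HANDOFF-H-g31 item 2): `B` = fixed-vertex / orbit incidence of an element `ρ` of order `11` of a hypothetical srg(333,166,82,83),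
`P`, `R` = an element `σ` of the centraliser of `ρ` acting on orbits / fixed vertices; then `Σ_j (t_j − f_j) ≥ 0` over the powers of `σ`, which
excludes the cycle type `33⁸·11⁴·3⁶·1⁷` of order `33` (Σ = −33).  WORDS: a general lemma (elementary); ours.  No `sorry`, no new definitions.
-/

namespace Summit.Ventures.DiscreteObjects.Hadamard

open Matrix

section intertwinedAverage
variable {m n : Type*} [Fintype m] [Fintype n] [DecidableEq m] [DecidableEq n]

/-- **Averaging**: for an orthogonal `P` of finite order `N` and a symmetric idempotent `Q` commuting with `P`, `0 ≤ Σ_{j<N} tr(Pʲ Q)`. -/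
theorem trace_sum_pow_mul_proj_nonneg (P Q : Matrix n n ℚ) (hP : Pᵀ * P = 1) {N : ℕ} (hN : 0 < N) (hPN : P ^ N = 1)
    (hQ2 : Q * Q = Q) (hQt : Qᵀ = Q) (hc : P * Q = Q * P) :
    0 ≤ ∑ j ∈ Finset.range N, trace (P ^ j * Q) := by
  set S : Matrix n n ℚ := ∑ j ∈ Finset.range N, P ^ j with hS
  -- P * S = S
  have hPS : P * S = S := by
    rw [hS, Finset.mul_sum]
    have e : ∀ j, P * P ^ j = P ^ (j + 1) := fun j => by rw [pow_succ']
    rw [Finset.sum_congr rfl fun j _ => e j]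
    have h1 := Finset.sum_range_succ (fun j => P ^ j) N
    have h2 := Finset.sum_range_succ' (fun j => P ^ j) N
    rw [hPN, pow_zero] at *
    rw [h1] at h2
    exact add_right_cancel h2.symm
  have hPkS : ∀ k : ℕ, P ^ k * S = S := by
    intro k; induction k with
    | zero => rw [pow_zero, Matrix.one_mul]
    | succ k ih => rw [pow_succ, Matrix.mul_assoc, hPS, ih]
  -- Pᵀ = P^(N-1), so Sᵀ S = N • S and Sᵀ = S
  have hPt : Pᵀ = P ^ (N - 1) := by
    have : Pᵀ * P ^ N = P ^ (N - 1) := by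
      conv_lhs => rw [show N = (N - 1) + 1 by omega, pow_succ', ← Matrix.mul_assoc, hP, Matrix.one_mul]
    rw [hPN, Matrix.mul_one] at this
    exact this
  have hStS : Sᵀ * S = (N : ℚ) • S := by
    have e1 : Sᵀ = ∑ j ∈ Finset.range N, P ^ ((N - 1) * j) := by
      rw [hS, Matrix.transpose_sum]
      refine Finset.sum_congr rfl fun j _ => ?_
      rw [Matrix.transpose_pow, hPt, ← pow_mul]
    rw [e1, Finset.sum_mul, Finset.sum_congr rfl fun j _ => hPkS ((N - 1) * j), Finset.sum_const, Finset.card_range]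
    exact (Nat.cast_smul_eq_nsmul ℚ N S).symm
  have hSt : Sᵀ = S := by
    have h := congrArg Matrix.transpose hStS
    rw [Matrix.transpose_mul, Matrix.transpose_transpose, Matrix.transpose_smul, hStS] at h
    have hN' : (N : ℚ) ≠ 0 := by exact_mod_cast hN.ne'
    have := smul_right_injective (Matrix n n ℚ) hN' h
    exact this.symm
  -- S commutes with Q
  have hPkQ : ∀ k : ℕ, P ^ k * Q = Q * P ^ k := by
    intro k; induction k with
    | zero => simp
    | succ k ih => rw [pow_succ, Matrix.mul_assoc, hc, ← Matrix.mul_assoc, ih, Matrix.mul_assoc]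
  have hSQ : S * Q = Q * S := by
    rw [hS, Finset.sum_mul, Finset.mul_sum]
    exact Finset.sum_congr rfl fun j _ => hPkQ j
  -- N · tr(S Q) = ‖S Q‖² ≥ 0
  have hkey : (N : ℚ) * trace (S * Q) = ∑ a, ∑ b, (S * Q) a b ^ 2 := by
    have e1 : (N : ℚ) * trace (S * Q) = trace (Sᵀ * S * Q) := by
      rw [hStS, Matrix.smul_mul, Matrix.trace_smul, smul_eq_mul]
    have e2 : Sᵀ * S * Q = (S * Q)ᵀ * (S * Q) := by
      rw [Matrix.transpose_mul, hQt, hSt]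
      calc S * S * Q = S * S * (Q * Q) := by rw [hQ2]
        _ = S * (S * Q) * Q := by simp only [Matrix.mul_assoc]
        _ = S * (Q * S) * Q := by rw [hSQ]
        _ = S * Q * (S * Q) := by simp only [Matrix.mul_assoc]
        _ = Q * S * (S * Q) := by rw [hSQ]
    rw [e1, e2]
    simp only [Matrix.trace, Matrix.diag_apply, Matrix.mul_apply, Matrix.transpose_apply]
    rw [Finset.sum_comm]
    exact Finset.sum_congr rfl fun a _ => Finset.sum_congr rfl fun b _ => by ring
  have hsum : ∑ j ∈ Finset.range N, trace (P ^ j * Q) = trace (S * Q) := by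
    rw [hS, Finset.sum_mul, Matrix.trace_sum]
  rw [hsum]
  have hnn : 0 ≤ (N : ℚ) * trace (S * Q) := by
    rw [hkey]; positivity
  have hNpos : (0 : ℚ) < N := by exact_mod_cast hN
  nlinarith

/-- `tr(P · BᵀKB) = tr R` for intertwined orthogonal `R`, `P` (`B Bᵀ K = 1`, `R K = K R`, `B P = R B`). -/
theorem trace_mul_proj_eq_of_intertwining (B : Matrix m n ℚ) (K : Matrix m m ℚ) (hBK : B * Bᵀ * K = 1)
    (R : Matrix m m ℚ) (P : Matrix n n ℚ) (hR : Rᵀ * R = 1) (hP : Pᵀ * P = 1) (hBP : B * P = R * B) :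
    trace (P * (Bᵀ * K * B)) = trace R := by
  have hKB : K * (B * Bᵀ) = 1 := mul_eq_one_comm.mp hBK
  have hP' : P * Pᵀ = 1 := mul_eq_one_comm.mp hP
  have hPB : P * Bᵀ = Bᵀ * R := by
    have e1 : Pᵀ * Bᵀ = Bᵀ * Rᵀ := by rw [← Matrix.transpose_mul, ← Matrix.transpose_mul, hBP]
    have e2 : Bᵀ = P * (Bᵀ * Rᵀ) := by rw [← e1, ← Matrix.mul_assoc, hP', Matrix.one_mul]
    calc P * Bᵀ = P * (Bᵀ * Rᵀ) * R := by rw [Matrix.mul_assoc, Matrix.mul_assoc, hR, Matrix.mul_one]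
      _ = Bᵀ * R := by rw [← e2]
  calc trace (P * (Bᵀ * K * B)) = trace (P * Bᵀ * (K * B)) := by rw [Matrix.mul_assoc, ← Matrix.mul_assoc P]
    _ = trace (Bᵀ * (R * (K * B))) := by rw [hPB, Matrix.mul_assoc]
    _ = trace (R * (K * B) * Bᵀ) := by rw [Matrix.trace_mul_comm, Matrix.mul_assoc]
    _ = trace (R * (K * (B * Bᵀ))) := by rw [Matrix.mul_assoc, Matrix.mul_assoc]
    _ = trace R := by rw [hKB, Matrix.mul_one]

/-- **Averaged rank test (abstract).**  If `B Bᵀ K = 1` (`Kᵀ = K`), `R`, `P` orthogonal of finite order `N` with `B P = R B` and `R K = K R`,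
then `0 ≤ Σ_{j<N} (tr Pʲ − tr Rʲ)`. -/
theorem trace_pow_sub_sum_nonneg_of_intertwining (B : Matrix m n ℚ) (K : Matrix m m ℚ) (hBK : B * Bᵀ * K = 1) (hKt : Kᵀ = K)
    (R : Matrix m m ℚ) (P : Matrix n n ℚ) (hR : Rᵀ * R = 1) (hP : Pᵀ * P = 1) (hRK : R * K = K * R) (hBP : B * P = R * B)
    {N : ℕ} (hN : 0 < N) (hPN : P ^ N = 1) :
    0 ≤ ∑ j ∈ Finset.range N, (trace (P ^ j) - trace (R ^ j)) := by
  set M := Bᵀ * K * B with hM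
  -- M symmetric idempotent commuting with P (as in IntertwinedTraceBound)
  have hM2 : M * M = M := by
    have e : B * (Bᵀ * (K * B)) = B := by rw [← Matrix.mul_assoc, ← Matrix.mul_assoc, hBK, Matrix.one_mul]
    calc M * M = Bᵀ * (K * (B * (Bᵀ * (K * B)))) := by simp only [hM, Matrix.mul_assoc]
      _ = Bᵀ * (K * B) := by rw [e]
      _ = M := by rw [hM, Matrix.mul_assoc]
  have hMt : Mᵀ = M := by
    rw [hM, Matrix.transpose_mul, Matrix.transpose_mul, Matrix.transpose_transpose, hKt, Matrix.mul_assoc]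
  -- powers: orthogonality, commuting with K, intertwining
  have hP1 : P * Pᵀ = 1 := mul_eq_one_comm.mp hP
  have hR1 : R * Rᵀ = 1 := mul_eq_one_comm.mp hR
  have hPk : ∀ k : ℕ, (P ^ k)ᵀ * P ^ k = 1 := fun k => by
    have hcP : Commute Pᵀ P := by rw [Commute, SemiconjBy, hP, hP1]
    rw [Matrix.transpose_pow, ← hcP.mul_pow, hP, one_pow]
  have hRk : ∀ k : ℕ, (R ^ k)ᵀ * R ^ k = 1 := fun k => by
    have hcR : Commute Rᵀ R := by rw [Commute, SemiconjBy, hR, hR1]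
    rw [Matrix.transpose_pow, ← hcR.mul_pow, hR, one_pow]
  have hBPk : ∀ k : ℕ, B * P ^ k = R ^ k * B := by
    intro k; induction k with
    | zero => simp
    | succ k ih => rw [pow_succ, ← Matrix.mul_assoc, ih, Matrix.mul_assoc, hBP, ← Matrix.mul_assoc, ← pow_succ]
  have htr : ∀ k : ℕ, trace (P ^ k * M) = trace (R ^ k) := fun k =>
    trace_mul_proj_eq_of_intertwining B K hBK (R ^ k) (P ^ k) (hRk k) (hPk k) (hBPk k)
  -- P commutes with M
  have hP' : P * Pᵀ = 1 := mul_eq_one_comm.mp hP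
  have hPB : P * Bᵀ = Bᵀ * R := by
    have e1 : Pᵀ * Bᵀ = Bᵀ * Rᵀ := by rw [← Matrix.transpose_mul, ← Matrix.transpose_mul, hBP]
    have e2 : Bᵀ = P * (Bᵀ * Rᵀ) := by rw [← e1, ← Matrix.mul_assoc, hP', Matrix.one_mul]
    calc P * Bᵀ = P * (Bᵀ * Rᵀ) * R := by rw [Matrix.mul_assoc, Matrix.mul_assoc, hR, Matrix.mul_one]
      _ = Bᵀ * R := by rw [← e2]
  have hPM : P * M = M * P := by
    calc P * M = P * Bᵀ * (K * B) := by rw [hM, Matrix.mul_assoc, ← Matrix.mul_assoc P]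
      _ = Bᵀ * (R * K) * B := by rw [hPB, Matrix.mul_assoc, Matrix.mul_assoc, Matrix.mul_assoc]
      _ = Bᵀ * (K * R) * B := by rw [hRK]
      _ = Bᵀ * K * (R * B) := by rw [Matrix.mul_assoc, Matrix.mul_assoc, Matrix.mul_assoc]
      _ = Bᵀ * K * (B * P) := by rw [hBP]
      _ = M * P := by simp only [hM, Matrix.mul_assoc]
  -- Q = 1 − M
  have hQ2 : (1 - M) * (1 - M) = 1 - M := by
    rw [Matrix.sub_mul, Matrix.mul_sub, Matrix.mul_sub, Matrix.one_mul, Matrix.mul_one, Matrix.one_mul, hM2]; abel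
  have hQt : (1 - M)ᵀ = 1 - M := by rw [Matrix.transpose_sub, Matrix.transpose_one, hMt]
  have hcQ : P * (1 - M) = (1 - M) * P := by rw [Matrix.mul_sub, Matrix.sub_mul, Matrix.mul_one, Matrix.one_mul, hPM]
  have hav := trace_sum_pow_mul_proj_nonneg P (1 - M) hP hN hPN hQ2 hQt hcQ
  have e : ∀ j, trace (P ^ j * (1 - M)) = trace (P ^ j) - trace (R ^ j) := fun j => by
    rw [Matrix.mul_sub, Matrix.trace_sub, Matrix.mul_one, htr j]
  rw [Finset.sum_congr rfl fun j _ => e j] at hav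
  exact hav

end intertwinedAverage

end Summit.Ventures.DiscreteObjects.Hadamard
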